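import Summits.QuantumFields.BalabanUV.Beta.SecondOrderRemainderTables

/-!
# `BalabanUV.Beta.SecondOrderSeparation` — binder row D1, the W-side (L4) of the reflection binder hR, leaf (W-REM-LOC-LIT), part 1:
# SEPARATION-DECAYING BI-LOCALISATION OF THE SECOND-ORDER SLOT KERNELS — `vertex2OfK K N R₂ b c` of a `LocStencil₂` family is bi-localised
# at the dilated FIRST bond `(N•y, N•y)` with a constant decaying in the bond separation `|N•y − N•y′|` (the shape the remainder class
# induction over the owner's `hR2succ` needs — the `hV` input of `SecondOrderStepRemainderWall.…_of_residual`)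
# (β sub-cell, D1 formalisation swarm seat `b2b-balaban-beta-d1-formalise-leaf-05`, gen 5; plan journal l.11904, INFO-1 (β) of l.11855)

HONEST FRAMING (cell contract, verbatim): «discharging `BetaPertH` makes Bałaban's UV stability UNCONDITIONAL — a real
constructive-QFT result; it is NOT the continuum limit and NOT the Clay problem.»  HONEST DEPENDENCY (verbatim): «continuum YM on T⁴ ⇐
BetaPertH ∧ nine spine estimates (0/9 proved); BetaPertH ⇐ (D1) ∧ (D4) ∧ CAP+tail; G-an2-4 gates asym, D1 and NE2/3/4.»  [folklore]
analysis bookkeeping over tree objects BY NAME; no statement of Bałaban's papers, no `[cite:]` tag, no `def`, no `Prop` fact; instantiates NO binder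
of the β-function wall; NOT D1, NOT `BetaPertH`, NOT continuum, NOT Clay.  ABSOLUTE RULE (cell, verbatim): «No internally-minted statement may
enter as a cited fact. Every hypothesis is either kernel-proved in this package or a verbatim quotation of a PUBLISHED theorem with page reference.
The manuscript(s) under audit are NOT citable for their own disputed steps — they are the thing under adjudication; programme-internal
(2001/route/tribunal) claims are never citable.»  Nothing is cited here.

## What is proved (generic `D`∕`d`, `N`, kernel `K`)

* §1 two-centre tools: `exp_two_centre_le` (`e^{−m|u−a|}·e^{−m|u−b|} ≤ e^{−(m/2)|a−b|}·e^{−(m/2)|u−a|}`), `abs_wsumTerm_fixed_le` and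
  **`biLoc_wsum_fixed`**: a weighted superposition of kernels all bi-localised at ONE centre `q` with constants decaying in the distance of
  their index from `q`, against weights decaying from `p`, is bi-localised at `q` with a constant `∝ e^{−(m/2)|q−p|}` (termwise bound +
  `tsum_of_norm_bounded`, the pattern of Literature `OneStepResolventKernel.biLoc_wsum`).
* §2 **`biLoc_innerRead`**: the second-bond read `vertexOfK K N (R₂ κ u) ν y′` of a `LocStencil₂` family through a decaying `K` is bi-localised at
  the first bond `(u, u)` with constant `∝ e^{−(m/2)|u − N•y′|}`.
* §3 `abs_outerTerm_le`, **`biLoc_vertex2OfK_sep`**: `Decays K C m`, `LocStencil₂ R₂ C₂ m` ⇒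
  `BiLoc (vertex2OfK K N R₂ μ y ν y′) (N•y) (N•y) (C′·e^{−(m/4)·l1 (N•y − N•y′)}) (3m/8)` — the bi-vertex is localised at the dilated first bond
  with a constant decaying in the separation of the two coarse bonds (Literature `vertexFamily₂_vertex2OfK` has the two-centre form with a
  separation-blind constant).
Provenance: b2b-balaban β sub-cell, D1 formalisation swarm leaf-05 gen 5, 2026-08-20 (v1); no existing file touched.
-/

noncomputable section

open Finset
open scoped BigOperators
open Literature.MathematicalPhysics.QuantumFieldTheory
open Literature.MathematicalPhysics.QuantumFieldTheory.Balaban1983to89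
open Literature.MathematicalPhysics.QuantumFieldTheory.Balaban1983to89.Beta
open B12Sec2to5 (l1 l1_nonneg)
open ExpKernelCalculus (MKer Site Decays BiLoc Zl Zl_nonneg summable_exp_shift tsum_exp_shift l1_sub_triangle l1_sub_symm)
open OneStepResolventKernel (Fib wsum LocStencil biLoc_finset_sum)
open OneStepKernelFamily (colH vertexOfK abs_colH_le)
open BalabanCompositeJets (LocStencil₂)
open SecondOrderResponse (vertex2OfK)

namespace Summit.QuantumFields.BalabanUV.Beta.SecondOrderSeparation

/-! ## §1 Two-centre tools; superpositions of kernels localised at ONE centre -/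

section Fixed

variable {D : ℕ} {F : Type*}

/-- [folklore] **TWO-CENTRE INEQUALITY**: `e^{−m|u−a|}·e^{−m|u−b|} ≤ e^{−(m/2)|a−b|}·e^{−(m/2)|u−a|}` (`m ≥ 0`; triangle inequality). -/
theorem exp_two_centre_le {m : ℝ} (hm : 0 ≤ m) (u a b : Site D) :
    Real.exp (-m * l1 (u - a)) * Real.exp (-m * l1 (u - b)) ≤ Real.exp (-(m / 2) * l1 (a - b)) * Real.exp (-(m / 2) * l1 (u - a)) := by
  rw [← Real.exp_add, ← Real.exp_add]
  refine Real.exp_le_exp.2 ?_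
  have t : l1 (a - b) ≤ l1 (a - u) + l1 (u - b) := l1_sub_triangle a u b
  have s : l1 (a - u) = l1 (u - a) := l1_sub_symm a u
  rw [s] at t
  nlinarith [l1_nonneg (u - a), l1_nonneg (u - b), mul_nonneg hm (l1_nonneg (u - b)),
    mul_nonneg hm (show 0 ≤ l1 (u - a) + l1 (u - b) - l1 (a - b) by linarith)]

/-- [folklore] Termwise bound for a superposition of kernels bi-localised at ONE centre `q` (constants decaying in `|u − q|`) against weights
decaying from `p`. -/
theorem abs_wsumTerm_fixed_le {w : Site D → ℝ} {T : Site D → MKer D F} {C Ck m δ : ℝ} {p q : Site D}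
    (hw : ∀ u, |w u| ≤ C * Real.exp (-m * l1 (u - p))) (hT : ∀ u, BiLoc (T u) q q (Ck * Real.exp (-m * l1 (u - q))) δ)
    (hm : 0 ≤ m) (hC : 0 ≤ C) (hCk : 0 ≤ Ck) (x z : Site D) (a b : F) (u : Site D) :
    |w u * T u x z a b| ≤
      C * Ck * Real.exp (-(m / 2) * l1 (q - p)) * Real.exp (-δ * (l1 (x - q) + l1 (z - q))) * Real.exp (-(m / 2) * l1 (u - q)) := by
  rw [abs_mul]
  have h1 := hw u
  have h2 := hT u x z a b
  have hC1 : 0 ≤ C * Real.exp (-m * l1 (u - p)) := by positivity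
  have key := exp_two_centre_le hm u q p
  calc |w u| * |T u x z a b|
      ≤ (C * Real.exp (-m * l1 (u - p))) * (Ck * Real.exp (-m * l1 (u - q)) * Real.exp (-δ * (l1 (x - q) + l1 (z - q)))) :=
        mul_le_mul h1 h2 (abs_nonneg _) hC1
    _ = C * Ck * Real.exp (-δ * (l1 (x - q) + l1 (z - q))) * (Real.exp (-m * l1 (u - q)) * Real.exp (-m * l1 (u - p))) := by ring
    _ ≤ C * Ck * Real.exp (-δ * (l1 (x - q) + l1 (z - q))) * (Real.exp (-(m / 2) * l1 (q - p)) * Real.exp (-(m / 2) * l1 (u - q))) :=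
        mul_le_mul_of_nonneg_left key (by positivity)
    _ = _ := by ring

/-- [folklore] **SUPERPOSITION OF KERNELS LOCALISED AT ONE CENTRE**: weights `|w u| ≤ C·e^{−m|u−p|}`, kernels `T u` bi-localised at `(q, q)` at
rate `δ` with constants `Ck·e^{−m|u−q|}` ⇒ `wsum w T` is bi-localised at `(q, q)` at rate `δ` with constant `C·Ck·Zl(m/2)·e^{−(m/2)|q−p|}`. -/
theorem biLoc_wsum_fixed {w : Site D → ℝ} {T : Site D → MKer D F} {C Ck m δ : ℝ} {p q : Site D}
    (hw : ∀ u, |w u| ≤ C * Real.exp (-m * l1 (u - p))) (hT : ∀ u, BiLoc (T u) q q (Ck * Real.exp (-m * l1 (u - q))) δ)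
    (hm : 0 < m) (hC : 0 ≤ C) (hCk : 0 ≤ Ck) :
    BiLoc (wsum w T) q q (C * Ck * Zl D (m / 2) * Real.exp (-(m / 2) * l1 (q - p))) δ := by
  intro x z a b
  unfold OneStepResolventKernel.wsum
  have hs := summable_exp_shift (half_pos hm) q
  have hs' : Summable fun u : Site D => Real.exp (-(m / 2) * l1 (u - q)) :=
    hs.congr fun u => by rw [l1_sub_symm]
  have hmaj := hs'.mul_left (C * Ck * Real.exp (-(m / 2) * l1 (q - p)) * Real.exp (-δ * (l1 (x - q) + l1 (z - q))))
  have hb := tsum_of_norm_bounded hmaj.hasSum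
    (fun u => by rw [Real.norm_eq_abs]; exact abs_wsumTerm_fixed_le hw hT hm.le hC hCk x z a b u)
  rw [Real.norm_eq_abs] at hb
  refine hb.trans (le_of_eq ?_)
  have ht : ∑' u : Site D, Real.exp (-(m / 2) * l1 (u - q)) = Zl D (m / 2) := by
    rw [← tsum_exp_shift (c := m / 2) q]
    exact tsum_congr fun u => by rw [l1_sub_symm]
  rw [tsum_mul_left, ht]
  ring

end Fixed

/-! ## §2 The second-bond read of a `LocStencil₂` family -/

section Inner

variable {d N : ℕ}

/-- [folklore] **THE SECOND-BOND READ OF A LOCAL BI-STENCIL FAMILY IS LOCALISED AT THE FIRST BOND, WITH SEPARATION DECAY**: for `K` decaying at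
rate `m` and `LocStencil₂ R₂ C₂ m`, `vertexOfK K N (R₂ κ u) ν y′` is bi-localised at `(u, u)` (rate `m`) with constant
`(d+1)·C·C₂·Zl(m/2)·e^{−(m/2)|u − N•y′|}`. -/
theorem biLoc_innerRead {K : MKer (d + 1) (Fib d)} {C m : ℝ} (hK : Decays K C m) (hm : 0 < m)
    {R₂ : Fin (d + 1) → (Fin (d + 1) → ℤ) → Fin (d + 1) → (Fin (d + 1) → ℤ) → MKer (d + 1) (Fib d)} {C₂ : ℝ} (hR₂ : LocStencil₂ R₂ C₂ m)
    (κ : Fin (d + 1)) (u : Fin (d + 1) → ℤ) (ν : Fin (d + 1)) (y' : Fin (d + 1) → ℤ) :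
    BiLoc (vertexOfK K N (R₂ κ u) ν y') u u
      ((d + 1 : ℕ) * (C * C₂ * Zl (d + 1) (m / 2) * Real.exp (-(m / 2) * l1 (u - (N : ℤ) • y')))) m := by
  have hC : 0 ≤ C := hK.nonneg (Sum.inl 0)
  have hC₂ : 0 ≤ C₂ := hR₂.nonneg
  have hterm : ∀ κ' : Fin (d + 1), BiLoc (wsum (colH K N ν y' κ') (R₂ κ u κ')) u u
      (C * C₂ * Zl (d + 1) (m / 2) * Real.exp (-(m / 2) * l1 (u - (N : ℤ) • y'))) m := fun κ' =>
    biLoc_wsum_fixed (fun u' => abs_colH_le (N := N) hK ν y' κ' u') (fun u' => hR₂ κ u κ' u') hm hC hC₂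
  have hsum := biLoc_finset_sum (Finset.univ : Finset (Fin (d + 1))) (fun κ' _ => hterm κ')
  simp only [Finset.sum_const, Finset.card_univ, Fintype.card_fin, nsmul_eq_mul] at hsum
  exact hsum

end Inner

/-! ## §3 The bi-vertex: localised at the dilated first bond with separation decay -/

section Outer

variable {d N : ℕ}

/-- [folklore] Termwise bound for the outer read: weights decaying from `P := N•y`, kernels bi-localised at their own index `u` (rate `m`)
with constants `A·e^{−(m/2)|u − Q|}`, `Q := N•y′` ⇒ each term is bounded by
`C·A·e^{−(m/4)|P−Q|}·e^{−(3m/8)(|x−P|+|z−P|)}·e^{−(5m/8)|x−u|}`. -/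
theorem abs_outerTerm_le {w : Site (d + 1) → ℝ} {T : Site (d + 1) → MKer (d + 1) (Fib d)} {C A m : ℝ} {P Q : Site (d + 1)}
    (hw : ∀ u, |w u| ≤ C * Real.exp (-m * l1 (u - P))) (hT : ∀ u, BiLoc (T u) u u (A * Real.exp (-(m / 2) * l1 (u - Q))) m)
    (hm : 0 ≤ m) (hC : 0 ≤ C) (hA : 0 ≤ A) (x z : Site (d + 1)) (a b : Fib d) (u : Site (d + 1)) :
    |w u * T u x z a b| ≤
      C * A * Real.exp (-(m / 4) * l1 (P - Q)) * Real.exp (-(3 * m / 8) * (l1 (x - P) + l1 (z - P))) *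
        Real.exp (-(5 * m / 8) * l1 (x - u)) := by
  rw [abs_mul]
  have h1 := hw u
  have h2 := hT u x z a b
  have hC1 : 0 ≤ C * Real.exp (-m * l1 (u - P)) := by positivity
  calc |w u| * |T u x z a b|
      ≤ (C * Real.exp (-m * l1 (u - P))) * (A * Real.exp (-(m / 2) * l1 (u - Q)) * Real.exp (-m * (l1 (x - u) + l1 (z - u)))) :=
        mul_le_mul h1 h2 (abs_nonneg _) hC1
    _ = C * A * Real.exp (-m * l1 (u - P) + -(m / 2) * l1 (u - Q) + -m * (l1 (x - u) + l1 (z - u))) := by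
        rw [Real.exp_add, Real.exp_add]; ring
    _ ≤ C * A * Real.exp (-(m / 4) * l1 (P - Q) + -(3 * m / 8) * (l1 (x - P) + l1 (z - P)) + -(5 * m / 8) * l1 (x - u)) := by
        refine mul_le_mul_of_nonneg_left (Real.exp_le_exp.2 ?_) (mul_nonneg hC hA)
        have t1 : l1 (P - Q) ≤ l1 (P - u) + l1 (u - Q) := l1_sub_triangle P u Q
        have t2 : l1 (x - P) ≤ l1 (x - u) + l1 (u - P) := l1_sub_triangle x u P
        have t3 : l1 (z - P) ≤ l1 (z - u) + l1 (u - P) := l1_sub_triangle z u P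
        have s1 : l1 (P - u) = l1 (u - P) := l1_sub_symm P u
        rw [s1] at t1
        nlinarith [mul_nonneg hm (show 0 ≤ l1 (u - P) + l1 (u - Q) - l1 (P - Q) by linarith),
          mul_nonneg hm (show 0 ≤ l1 (x - u) + l1 (u - P) - l1 (x - P) by linarith),
          mul_nonneg hm (show 0 ≤ l1 (z - u) + l1 (u - P) - l1 (z - P) by linarith),
          mul_nonneg hm (l1_nonneg (u - Q)), mul_nonneg hm (l1_nonneg (z - u))]
    _ = _ := by rw [Real.exp_add, Real.exp_add]; ring

/-- [folklore] The outer read, abstractly: `wsum w T` for weights decaying from `P` and kernels at their own index with constants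
`A·e^{−(m/2)|u−Q|}` is bi-localised at `(P, P)` (rate `3m/8`) with constant `C·A·Zl(5m/8)·e^{−(m/4)|P−Q|}`. -/
theorem biLoc_wsum_outer {w : Site (d + 1) → ℝ} {T : Site (d + 1) → MKer (d + 1) (Fib d)} {C A m : ℝ} {P Q : Site (d + 1)}
    (hw : ∀ u, |w u| ≤ C * Real.exp (-m * l1 (u - P))) (hT : ∀ u, BiLoc (T u) u u (A * Real.exp (-(m / 2) * l1 (u - Q))) m)
    (hm : 0 < m) (hC : 0 ≤ C) (hA : 0 ≤ A) :
    BiLoc (wsum w T) P P (C * A * Zl (d + 1) (5 * m / 8) * Real.exp (-(m / 4) * l1 (P - Q))) (3 * m / 8) := by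
  intro x z a b
  unfold OneStepResolventKernel.wsum
  have h58 : 0 < 5 * m / 8 := by positivity
  have hs := summable_exp_shift h58 x
  have hmaj := hs.mul_left (C * A * Real.exp (-(m / 4) * l1 (P - Q)) * Real.exp (-(3 * m / 8) * (l1 (x - P) + l1 (z - P))))
  have hb := tsum_of_norm_bounded hmaj.hasSum
    (fun u => by rw [Real.norm_eq_abs]; exact abs_outerTerm_le hw hT hm.le hC hA x z a b u)
  rw [Real.norm_eq_abs] at hb
  refine hb.trans (le_of_eq ?_)
  rw [tsum_mul_left, tsum_exp_shift]
  ring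

/-- [folklore] **THE BI-VERTEX OF A LOCAL BI-STENCIL FAMILY IS LOCALISED AT THE DILATED FIRST BOND WITH SEPARATION DECAY**:
`Decays K C m`, `LocStencil₂ R₂ C₂ m` ⇒ `BiLoc (vertex2OfK K N R₂ μ y ν y′) (N•y) (N•y) (C′·e^{−(m/4)·l1 (N•y − N•y′)}) (3m/8)` with
`C′ = (d+1)·C·((d+1)·C·C₂·Zl(m/2))·Zl(5m/8)`. -/
theorem biLoc_vertex2OfK_sep {K : MKer (d + 1) (Fib d)} {C m : ℝ} (hK : Decays K C m) (hm : 0 < m)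
    {R₂ : Fin (d + 1) → (Fin (d + 1) → ℤ) → Fin (d + 1) → (Fin (d + 1) → ℤ) → MKer (d + 1) (Fib d)} {C₂ : ℝ} (hR₂ : LocStencil₂ R₂ C₂ m)
    (μ : Fin (d + 1)) (y : Fin (d + 1) → ℤ) (ν : Fin (d + 1)) (y' : Fin (d + 1) → ℤ) :
    BiLoc (vertex2OfK K N R₂ μ y ν y') ((N : ℤ) • y) ((N : ℤ) • y)
      ((d + 1 : ℕ) * (C * ((d + 1 : ℕ) * (C * C₂ * Zl (d + 1) (m / 2))) * Zl (d + 1) (5 * m / 8) *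
        Real.exp (-(m / 4) * l1 ((N : ℤ) • y - (N : ℤ) • y')))) (3 * m / 8) := by
  have hC : 0 ≤ C := hK.nonneg (Sum.inl 0)
  have hC₂ : 0 ≤ C₂ := hR₂.nonneg
  have hZ : 0 ≤ Zl (d + 1) (m / 2) := Zl_nonneg (half_pos hm)
  have hA : 0 ≤ (d + 1 : ℕ) * (C * C₂ * Zl (d + 1) (m / 2)) := by positivity
  have hin : ∀ (κ : Fin (d + 1)) (u : Fin (d + 1) → ℤ), BiLoc (vertexOfK K N (R₂ κ u) ν y') u u
      ((d + 1 : ℕ) * (C * C₂ * Zl (d + 1) (m / 2)) * Real.exp (-(m / 2) * l1 (u - (N : ℤ) • y'))) m := by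
    intro κ u
    have h := biLoc_innerRead (N := N) hK hm hR₂ κ u ν y'
    rwa [← mul_assoc] at h
  have hterm : ∀ κ : Fin (d + 1), BiLoc (wsum (colH K N μ y κ) (fun u => vertexOfK K N (R₂ κ u) ν y')) ((N : ℤ) • y) ((N : ℤ) • y)
      (C * ((d + 1 : ℕ) * (C * C₂ * Zl (d + 1) (m / 2))) * Zl (d + 1) (5 * m / 8) *
        Real.exp (-(m / 4) * l1 ((N : ℤ) • y - (N : ℤ) • y'))) (3 * m / 8) := fun κ =>
    biLoc_wsum_outer (fun u => abs_colH_le (N := N) hK μ y κ u) (fun u => hin κ u) hm hC hA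
  have hsum := biLoc_finset_sum (Finset.univ : Finset (Fin (d + 1))) (fun κ _ => hterm κ)
  simp only [Finset.sum_const, Finset.card_univ, Fintype.card_fin, nsmul_eq_mul] at hsum
  exact hsum

end Outer

end Summit.QuantumFields.BalabanUV.Beta.SecondOrderSeparation

end
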